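import Mathlib
import HarnessLib
import Summits.Ventures.LatticeQCDFlow.Scoring.IMHLevelDecomposition

/-!
# The windowless and windowed τ laws of the level decomposition:
# `τ_int(f) = (⟨φ, h⟩ + E_p[v/a]) / (Var φ + E_p[v]) − 1/2`, a mediant

HONEST FRAMING: exact (Metropolis-corrected) sampling algorithms for lattice gauge theory;
figures of merit are autocorrelation/cost numbers at stated couplings and volumes; no
continuum-physics claim.

Venture `LatticeQCDFlow` (cell pub-lqcd), topic `Scoring`; FANOUT row 8 (`s0-cpn-nemc`, GEN-10).
NEW WORK of the cell (finite mixtures of geometric series over the algebra of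
`Scoring/IMHLevelDecomposition.lean`), not a published result; the `τ` half of statement (T3),
general form, of the flow seat's `HOME/canary-flow/imhlaw/IMH-LAW-flow.md`, on the tree's
`Scoring.tauInt · tauIntWindow`; nothing cited as a fact, no definition added.

## Content (setting of `IMHLevelDecomposition.lean`: `p = pL ⊗ μ`, `q = qL ⊗ μ`, level function `φ`,
## level-wise centred residual `ε`, `v l = Σ_y μ y ε (l, y)²`, `a l = 1 − liuG pL qL l l`; `qL > 0`)

* `abs_liuG_diag_lt_one` — `|1 − a(l)| < 1` for a positive model law.
* **`hasSum_twoTime_level_add_resid`** — GREEN–KUBO for a centred `f = φ ∘ fst + ε`: with `h` a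
  Poisson solution of the LEVEL chain for `φ`,
  `Σ_{t ≥ 0} S_t(f, f) = S^L_0(φ, h) + Σ_l pL l · v l / a l` (`HasSum`; the level part is
  `IMHGreenKubo.imh_greenKubo_hasSum`, the residual part a finite mixture of geometric series).
* **`tauInt_level_add_resid`** —
  `τ_int(f) = (S^L_0(φ, h) + Σ_l pL l v l / a l) / (S^L_0(φ, φ) + Σ_l pL l v l) − 1/2`
  on the tree's `tauInt`.
* `mediant_mem_uIcc`, **`tauInt_level_add_resid_mem_uIcc`** — hence `τ_int(f)` lies BETWEEN the
  level mean's `τ_int(φ)` under the weight process (`IMHGreenKubo.imh_tauInt_eq`) and the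
  `v`-weighted mean holding time `(Σ_l pL l v l / a l) / (Σ_l pL l v l) − 1/2`.
* `tauIntWindow_resid` — the WINDOWED weight-blind law ((T3)'s `τ_blind(W)`): for a pure residual
  (`φ = 0`), `τ_N = 1/2 + (Σ_l pL l v l · G l (1 − G lᴺ)/(1 − G l)) / Σ_l pL l v l`, `G = 1 − a` —
  what any window `N` sees of `E_p[v/a] − 1/2` (for `v` constant this is the flow seat's
  `1/2 + E_π[(1 − a)(1 − (1 − a)ᴺ)/a]`).
-/


namespace Summit.Ventures.LatticeQCDFlow.Scoring

open Finset Literature.Probability.MarkovChains Summit.Ventures.LatticeQCDFlow.Exactness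

section AnySpace

variable {X : Type*} [Fintype X] [DecidableEq X]

/-- The mediant of two fractions with positive denominators lies between them. -/
theorem mediant_mem_uIcc {A B C D : ℝ} (hB : 0 < B) (hD : 0 < D) :
    (A + C) / (B + D) ∈ Set.uIcc (A / B) (C / D) := by
  have hBD : 0 < B + D := add_pos hB hD
  rw [Set.mem_uIcc]
  rcases le_total (A * D) (C * B) with h | h
  · left
    constructor
    · rw [div_le_div_iff₀ hB hBD]; nlinarith
    · rw [div_le_div_iff₀ hBD hD]; nlinarith
  · right
    constructor
    · rw [div_le_div_iff₀ hD hBD]; nlinarith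
    · rw [div_le_div_iff₀ hBD hB]; nlinarith

end AnySpace

section Level

variable {L Y : Type*} [Fintype L] [DecidableEq L] [Fintype Y] [DecidableEq Y]
variable {pL qL : L → ℝ} {μ : Y → ℝ}
/-! ### The windowless law for the decomposition -/

/-- The rejection probability `G l l = 1 − a(l)` of a level lies in `[0, 1)` for a positive model
law (`|G l l| < 1`). -/
theorem abs_liuG_diag_lt_one (hpL : ∀ l, 0 < pL l) (hqL : ∀ l, 0 < qL l) (hqL1 : ∑ l, qL l = 1)
    (l : L) : |liuG pL qL l l| < 1 := by
  have ha := one_sub_liuG_diag_pos hpL hqL l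
  have h1 := one_sub_liuG_diag_le_one hpL hqL1 l
  rw [abs_lt]
  constructor <;> linarith

/-- **Green–Kubo for the decomposition.**  For a `pL`-centred level function `φ` with a Poisson
solution `h` of the LEVEL chain (`h l − Σ_{l'} K_L l l' h l' = φ l`) and a level-wise centred
residual `ε`:
`Σ_{t ≥ 0} S_t(φ ∘ fst + ε, φ ∘ fst + ε) = S^L_0(φ, h) + Σ_l pL l · v l / a l` (`HasSum`; the level
part is `IMHGreenKubo.imh_greenKubo_hasSum`, the residual part a finite mixture of geometric series). -/
theorem hasSum_twoTime_level_add_resid (hpL : ∀ l, 0 < pL l) (hpL1 : ∑ l, pL l = 1)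
    (hqL : ∀ l, 0 < qL l) (hqL1 : ∑ l, qL l = 1) (hμ : ∀ y, 0 < μ y) (hμ1 : ∑ y, μ y = 1)
    {φ : L → ℝ} (hφ : ∑ l, pL l * φ l = 0) (h : L → ℝ)
    (hh : ∀ l, h l - ∑ l', imhKernel pL qL l l' * h l' = φ l)
    {ε : L × Y → ℝ} (hε : ∀ l, ∑ y, μ y * ε (l, y) = 0) :
    HasSum (fun t => twoTime (fun z : L × Y => pL z.1 * μ z.2)
        (imhMatrix (fun z : L × Y => pL z.1 * μ z.2) (fun z => qL z.1 * μ z.2)) t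
        (fun z => φ z.1 + ε z) (fun z => φ z.1 + ε z))
      (twoTime pL (imhMatrix pL qL) 0 φ h
        + ∑ l, pL l * (∑ y, μ y * ε (l, y) ^ 2) / (1 - liuG pL qL l l)) := by
  simp_rw [twoTime_level_add_resid hpL hμ hμ1 φ hε]
  refine HasSum.add ?_ (hasSum_sum fun l _ => ?_)
  · exact imh_greenKubo_hasSum hpL hpL1 (fun l => (hqL l).le) hqL1
      (weightBound_sum (fun l => (hpL l).le) hqL) φ h hφ hh
  · have hG := abs_liuG_diag_lt_one hpL hqL hqL1 l
    have hs := ((hasSum_geometric_of_abs_lt_one hG).mul_left (pL l)).mul_right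
      (∑ y, μ y * ε (l, y) ^ 2)
    have he : pL l * (∑ y, μ y * ε (l, y) ^ 2) / (1 - liuG pL qL l l)
        = pL l * (1 - liuG pL qL l l)⁻¹ * ∑ y, μ y * ε (l, y) ^ 2 := by
      rw [div_eq_mul_inv]
      ring
    rw [he]
    exact hs

/-- **`τ_int` of the decomposition**: for `f = φ ∘ fst + ε` as above with `S_0(f, f) ≠ 0`,
`tauInt ρ_f = (S^L_0(φ, h) + Σ_l pL l v l / a l) / (S^L_0(φ, φ) + Σ_l pL l v l) − 1/2`. -/
theorem tauInt_level_add_resid (hpL : ∀ l, 0 < pL l) (hpL1 : ∑ l, pL l = 1)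
    (hqL : ∀ l, 0 < qL l) (hqL1 : ∑ l, qL l = 1) (hμ : ∀ y, 0 < μ y) (hμ1 : ∑ y, μ y = 1)
    {φ : L → ℝ} (hφ : ∑ l, pL l * φ l = 0) (h : L → ℝ)
    (hh : ∀ l, h l - ∑ l', imhKernel pL qL l l' * h l' = φ l)
    {ε : L × Y → ℝ} (hε : ∀ l, ∑ y, μ y * ε (l, y) = 0)
    (hV : twoTime pL (imhMatrix pL qL) 0 φ φ + ∑ l, pL l * ∑ y, μ y * ε (l, y) ^ 2 ≠ 0) :
    tauInt (fun t => twoTime (fun z : L × Y => pL z.1 * μ z.2)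
          (imhMatrix (fun z : L × Y => pL z.1 * μ z.2) (fun z => qL z.1 * μ z.2)) t
          (fun z => φ z.1 + ε z) (fun z => φ z.1 + ε z) /
        twoTime (fun z : L × Y => pL z.1 * μ z.2)
          (imhMatrix (fun z : L × Y => pL z.1 * μ z.2) (fun z => qL z.1 * μ z.2)) 0
          (fun z => φ z.1 + ε z) (fun z => φ z.1 + ε z))
      = (twoTime pL (imhMatrix pL qL) 0 φ h
          + ∑ l, pL l * (∑ y, μ y * ε (l, y) ^ 2) / (1 - liuG pL qL l l))
        / (twoTime pL (imhMatrix pL qL) 0 φ φ + ∑ l, pL l * ∑ y, μ y * ε (l, y) ^ 2) - 1 / 2 := by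
  have hGK := hasSum_twoTime_level_add_resid hpL hpL1 hqL hqL1 hμ hμ1 hφ h hh hε
  have h0 : twoTime (fun z : L × Y => pL z.1 * μ z.2)
      (imhMatrix (fun z : L × Y => pL z.1 * μ z.2) (fun z => qL z.1 * μ z.2)) 0
      (fun z => φ z.1 + ε z) (fun z => φ z.1 + ε z)
      = twoTime pL (imhMatrix pL qL) 0 φ φ + ∑ l, pL l * ∑ y, μ y * ε (l, y) ^ 2 := by
    rw [twoTime_level_add_resid hpL hμ hμ1 φ hε 0]
    simp
  have h1 : HasSum (fun t => twoTime (fun z : L × Y => pL z.1 * μ z.2)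
        (imhMatrix (fun z : L × Y => pL z.1 * μ z.2) (fun z => qL z.1 * μ z.2)) (t + 1)
        (fun z => φ z.1 + ε z) (fun z => φ z.1 + ε z))
      (twoTime pL (imhMatrix pL qL) 0 φ h
          + ∑ l, pL l * (∑ y, μ y * ε (l, y) ^ 2) / (1 - liuG pL qL l l)
        - (twoTime pL (imhMatrix pL qL) 0 φ φ + ∑ l, pL l * ∑ y, μ y * ε (l, y) ^ 2)) := by
    have := (hasSum_nat_add_iff' (f := fun t => twoTime (fun z : L × Y => pL z.1 * μ z.2)
        (imhMatrix (fun z : L × Y => pL z.1 * μ z.2) (fun z => qL z.1 * μ z.2)) t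
        (fun z => φ z.1 + ε z) (fun z => φ z.1 + ε z)) 1).2 hGK
    simpa [sum_range_one, h0] using this
  unfold tauInt
  rw [h0, (h1.div_const _).tsum_eq]
  field_simp
  ring

/-- **`τ_int(f)` is a mediant**: with both parts non-degenerate (`S^L_0(φ, φ) > 0`, `Σ pL v > 0`),
`τ_int(φ ∘ fst + ε)` lies between the level mean's `τ_int(φ)` under the weight process and the
`v`-weighted mean holding time `(Σ_l pL l v l / a l) / (Σ_l pL l v l) − 1/2`. -/
theorem tauInt_level_add_resid_mem_uIcc (hpL : ∀ l, 0 < pL l) (hpL1 : ∑ l, pL l = 1)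
    (hqL : ∀ l, 0 < qL l) (hqL1 : ∑ l, qL l = 1) (hμ : ∀ y, 0 < μ y) (hμ1 : ∑ y, μ y = 1)
    {φ : L → ℝ} (hφ : ∑ l, pL l * φ l = 0) (h : L → ℝ)
    (hh : ∀ l, h l - ∑ l', imhKernel pL qL l l' * h l' = φ l)
    {ε : L × Y → ℝ} (hε : ∀ l, ∑ y, μ y * ε (l, y) = 0)
    (hφ0 : 0 < twoTime pL (imhMatrix pL qL) 0 φ φ)
    (hv0 : 0 < ∑ l, pL l * ∑ y, μ y * ε (l, y) ^ 2) :
    tauInt (fun t => twoTime (fun z : L × Y => pL z.1 * μ z.2)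
          (imhMatrix (fun z : L × Y => pL z.1 * μ z.2) (fun z => qL z.1 * μ z.2)) t
          (fun z => φ z.1 + ε z) (fun z => φ z.1 + ε z) /
        twoTime (fun z : L × Y => pL z.1 * μ z.2)
          (imhMatrix (fun z : L × Y => pL z.1 * μ z.2) (fun z => qL z.1 * μ z.2)) 0
          (fun z => φ z.1 + ε z) (fun z => φ z.1 + ε z))
      ∈ Set.uIcc
          (tauInt (fun t => twoTime pL (imhMatrix pL qL) t φ φ / twoTime pL (imhMatrix pL qL) 0 φ φ))
          ((∑ l, pL l * (∑ y, μ y * ε (l, y) ^ 2) / (1 - liuG pL qL l l))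
              / (∑ l, pL l * ∑ y, μ y * ε (l, y) ^ 2) - 1 / 2) := by
  rw [tauInt_level_add_resid hpL hpL1 hqL hqL1 hμ hμ1 hφ h hh hε (by positivity),
    imh_tauInt_eq hpL hpL1 (fun l => (hqL l).le) hqL1 (weightBound_sum (fun l => (hpL l).le) hqL)
      φ h hφ hh hφ0.ne']
  have hm := mediant_mem_uIcc (A := twoTime pL (imhMatrix pL qL) 0 φ h)
    (C := ∑ l, pL l * (∑ y, μ y * ε (l, y) ^ 2) / (1 - liuG pL qL l l)) hφ0 hv0
  rw [Set.mem_uIcc] at hm ⊢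
  rcases hm with ⟨h1, h2⟩ | ⟨h1, h2⟩
  · exact Or.inl ⟨by linarith, by linarith⟩
  · exact Or.inr ⟨by linarith, by linarith⟩

/-! ### The windowed weight-blind law -/

/-- **(T3)'s windowed sum `τ_blind(N)`** for a pure residual (`φ = 0`, e.g. a weight-blind
observable): `tauIntWindow ρ_ε N = 1/2 + (Σ_l pL l v l · G l (1 − G lᴺ)/(1 − G l)) / Σ_l pL l v l`
with `G l = liuG pL qL l l = 1 − a(l)` — what any window `N` sees of `E_p[v/a] − 1/2`. -/
theorem tauIntWindow_resid (hpL : ∀ l, 0 < pL l) (hqL : ∀ l, 0 < qL l) (hqL1 : ∑ l, qL l = 1)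
    (hμ : ∀ y, 0 < μ y) (hμ1 : ∑ y, μ y = 1) {ε : L × Y → ℝ}
    (hε : ∀ l, ∑ y, μ y * ε (l, y) = 0) (N : ℕ) :
    tauIntWindow (fun t => twoTime (fun z : L × Y => pL z.1 * μ z.2)
          (imhMatrix (fun z : L × Y => pL z.1 * μ z.2) (fun z => qL z.1 * μ z.2)) t ε ε /
        twoTime (fun z : L × Y => pL z.1 * μ z.2)
          (imhMatrix (fun z : L × Y => pL z.1 * μ z.2) (fun z => qL z.1 * μ z.2)) 0 ε ε) N
      = 1 / 2 + (∑ l, pL l * (∑ y, μ y * ε (l, y) ^ 2)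
            * (liuG pL qL l l * (1 - liuG pL qL l l ^ N) / (1 - liuG pL qL l l)))
          / ∑ l, pL l * ∑ y, μ y * ε (l, y) ^ 2 := by
  simp_rw [twoTime_resid hpL hμ hμ1 hε]
  unfold tauIntWindow
  simp only [pow_zero, mul_one]
  rw [← sum_div, add_right_inj]
  congr 1
  rw [sum_comm]
  refine sum_congr rfl fun l _ => ?_
  have hG1 : liuG pL qL l l ≠ 1 := by
    have := abs_liuG_diag_lt_one hpL hqL hqL1 l
    rw [abs_lt] at this
    linarith [this.2]
  have hgeo : ∑ t ∈ range N, liuG pL qL l l ^ (t + 1)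
      = liuG pL qL l l * (1 - liuG pL qL l l ^ N) / (1 - liuG pL qL l l) := by
    have hg : ∑ t ∈ range N, liuG pL qL l l ^ (t + 1)
        = liuG pL qL l l * ∑ t ∈ range N, liuG pL qL l l ^ t := by
      rw [mul_sum]
      exact sum_congr rfl fun t _ => by ring
    rw [hg, geom_sum_eq hG1 N]
    have h2 : liuG pL qL l l - 1 ≠ 0 := sub_ne_zero.mpr hG1
    have h3 : 1 - liuG pL qL l l ≠ 0 := sub_ne_zero.mpr (Ne.symm hG1)
    field_simp
    ring
  rw [← hgeo, mul_sum]
  exact sum_congr rfl fun t _ => by ring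

end Level

end Summit.Ventures.LatticeQCDFlow.Scoring
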